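import Mathlib
import Literature.MathematicalPhysics.QuantumLattice.DWaveSource
import Literature.MathematicalPhysics.QuantumLattice.DWaveSourceProofs
import Literature.MathematicalPhysics.QuantumLattice.FinDimSpectrum
import Literature.MathematicalPhysics.QuantumLattice.ApproximatingHamiltonianProofs
import Literature.MathematicalPhysics.QuantumLattice.GibbsPressureTemperature

/-!
# Crux-triage round 1, triager 3 — Lean evidence on the thermal lever shared by the cards
`thermal-ratchet` ≈ `cooling-to-the-thermal-diagonal` ≈ `entropy-staircase-linear-regime`
(crux `TwSourcedCondensation`, item stmt-HubbardSuperconductivity-1697).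

1. `CruxTriage1697.not_thermalRatchetAbstract` — the ABSTRACT first lemma `thermalRatchet` of
   `SketchIdeator3.lean` is false as typed (coefficient `1` instead of `2` on `log Z(β₁/2,K₁)`;
   witness `Fin 1`, `K₀ = K₁ = (-1)•1`, `β₁ = β = 2`).
2. `CruxTriage1697.thermalRatchet_corrected` — the corrected abstract ratchet, PROVED from the tree's
   `GibbsPressureTemperature` (antitone pressure, entropy price, dyadic entropy bound).
3. `CruxTriage1697.thermalRatchet_dWaveSource` — the card's TORUS first lemma, verbatim signature,
   PROVED (it was always correctly normalised). rc 0, 0 sorry, axioms {propext, Classical.choice,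
   Quot.sound}.
-/



open Literature.MathematicalPhysics.QuantumLattice

namespace CruxTriage1697

/-- The abstract ratchet exactly as typed in `SketchIdeator3.lean` (`thermalRatchet`), as a Prop
(universe fixed to `Type`, binders explicit). -/
def ThermalRatchetAbstract : Prop :=
  ∀ (n : Type) [Fintype n] [DecidableEq n] [Nonempty n]
    (K₀ K₁ : Matrix n n ℂ), K₀.IsHermitian → K₁.IsHermitian →
    ∀ (β₁ β : ℝ), 0 < β₁ → β₁ ≤ β →
    (2 * Real.log (Matrix.partitionFn β₁ K₁).re - Real.log (Matrix.partitionFn (β₁ / 2) K₁).re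
        - Real.log (Matrix.partitionFn β₁ K₀).re) / β₁
      ≤ (Real.log (Matrix.partitionFn β K₁).re - Real.log (Matrix.partitionFn β K₀).re) / β

/-- `Z(b, 0) = 1` on `Fin 1`. -/
theorem partitionFn_zero_fin1 (b : ℝ) :
    Matrix.partitionFn b (0 : Matrix (Fin 1) (Fin 1) ℂ) = 1 := by
  simp [Matrix.partitionFn, Matrix.gibbsWeight, NormedSpace.exp_zero, Matrix.trace_one]

/-- The witness Hamiltonian `K = (-1)•1` on `Fin 1`. -/
noncomputable def Kneg : Matrix (Fin 1) (Fin 1) ℂ := (((-1 : ℝ) : ℂ)) • (1 : Matrix (Fin 1) (Fin 1) ℂ)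

theorem Kneg_isHermitian : Kneg.IsHermitian := by
  unfold Kneg
  rw [Matrix.IsHermitian, Matrix.conjTranspose_smul, Matrix.conjTranspose_one]
  simp

/-- `log Z(b, (-1)•1) = b` on `Fin 1`. -/
theorem log_partitionFn_Kneg (b : ℝ) : Real.log (Matrix.partitionFn b Kneg).re = b := by
  have h0 : (0 : Matrix (Fin 1) (Fin 1) ℂ).IsHermitian := Matrix.isHermitian_zero
  have h := log_partitionFn_add_smul_one h0 b (-1)
  rw [zero_add, partitionFn_zero_fin1] at h
  unfold Kneg
  rw [h]
  simp

/-- The abstract ratchet as typed is false. -/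
theorem not_thermalRatchetAbstract : ¬ ThermalRatchetAbstract := by
  intro H
  have key := H (Fin 1) Kneg Kneg Kneg_isHermitian Kneg_isHermitian 2 2 (by norm_num) le_rfl
  rw [log_partitionFn_Kneg, log_partitionFn_Kneg] at key
  norm_num at key

end CruxTriage1697




open Literature.MathematicalPhysics.QuantumLattice

namespace CruxTriage1697

theorem thermalRatchet_corrected {n : Type*} [Fintype n] [DecidableEq n] [Nonempty n]
    (K₀ K₁ : Matrix n n ℂ) (hK₀ : K₀.IsHermitian) (hK₁ : K₁.IsHermitian)
    {β₁ β : ℝ} (hβ₁ : 0 < β₁) (hle : β₁ ≤ β) :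
    (2 * Real.log (Matrix.partitionFn β₁ K₁).re - 2 * Real.log (Matrix.partitionFn (β₁ / 2) K₁).re
        - Real.log (Matrix.partitionFn β₁ K₀).re) / β₁
      ≤ (Real.log (Matrix.partitionFn β K₁).re - Real.log (Matrix.partitionFn β K₀).re) / β := by
  have hβ : 0 < β := lt_of_lt_of_le hβ₁ hle
  have hβh : 0 < β₁ / 2 := half_pos hβ₁
  -- the five pressures / the entropy at β₁
  set L11 := Real.log (Matrix.partitionFn β₁ K₁).re with hL11
  set L1h := Real.log (Matrix.partitionFn (β₁ / 2) K₁).re with hL1h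
  set L01 := Real.log (Matrix.partitionFn β₁ K₀).re with hL01
  set Lb1 := Real.log (Matrix.partitionFn β K₁).re with hLb1
  set Lb0 := Real.log (Matrix.partitionFn β K₀).re with hLb0
  set S := Real.log (Matrix.partitionFn β₁ K₁).re + β₁ * (Matrix.gibbsState β₁ K₁ K₁).re with hS
  -- (A) unsourced pressure is antitone in β
  have hA : Lb0 / β ≤ L01 / β₁ := log_partitionFn_div_antitone hK₀ hβ₁ hle
  -- (B) sourced pressure increment paid in entropy
  have hB : L11 / β₁ - Lb1 / β ≤ (β - β₁) / (β * β₁) * S :=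
    pressure_sub_pressure_le_entropy hK₁ hβ hβ₁
  -- (C) entropy dominated by the dyadic increment
  have hC : S ≤ 2 * L1h - L11 := entropy_le_two_mul_log_partitionFn_half_sub hK₁ hβ₁
  -- (D) the dyadic increment is non-negative (antitone again)
  have hD : L11 / β₁ ≤ L1h / (β₁ / 2) :=
    log_partitionFn_div_antitone hK₁ hβh (by linarith)
  have hD' : 0 ≤ 2 * L1h - L11 := by
    have h1 : L1h / (β₁ / 2) = 2 * L1h / β₁ := by field_simp
    rw [h1] at hD
    have h2 : L11 ≤ 2 * L1h := by
      have := (div_le_div_iff_of_pos_right hβ₁).mp hD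
      linarith
    linarith
  -- multiply out
  have hA' : Lb0 * β₁ ≤ L01 * β := (div_le_div_iff₀ hβ hβ₁).mp hA
  have hB' : L11 * β - Lb1 * β₁ ≤ (β - β₁) * S := by
    have hpos : 0 < β * β₁ := mul_pos hβ hβ₁
    have := mul_le_mul_of_nonneg_right hB hpos.le
    have e1 : (L11 / β₁ - Lb1 / β) * (β * β₁) = L11 * β - Lb1 * β₁ := by field_simp
    have e2 : (β - β₁) / (β * β₁) * S * (β * β₁) = (β - β₁) * S := by field_simp
    rw [e1, e2] at this
    exact this
  have hC' : (β - β₁) * S ≤ (β - β₁) * (2 * L1h - L11) :=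
    mul_le_mul_of_nonneg_left hC (sub_nonneg.2 hle)
  have hE : (β - β₁) * (2 * L1h - L11) ≤ β * (2 * L1h - L11) := by
    have : 0 ≤ β₁ * (2 * L1h - L11) := mul_nonneg hβ₁.le hD'
    nlinarith
  rw [div_le_div_iff₀ hβ₁ hβ]
  nlinarith

/-- Torus specialisation: verbatim the statement of `thermalRatchet_dWaveSource`
(SketchIdeator3.lean, card `thermal-ratchet`), now PROVED. -/
theorem thermalRatchet_dWaveSource (L : ℕ) [NeZero L] (U μ h : ℝ) {β₁ β : ℝ}
    (hβ₁ : 0 < β₁) (hle : β₁ ≤ β) :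
    ((Real.log (Matrix.partitionFn β₁ (dWaveSourceTorus L U μ h)).re / (β₁ * (L : ℝ) ^ 2)
        - Real.log (Matrix.partitionFn β₁ (dWaveSourceTorus L U μ 0)).re / (β₁ * (L : ℝ) ^ 2))
      - (Real.log (Matrix.partitionFn (β₁ / 2) (dWaveSourceTorus L U μ h)).re / (β₁ / 2 * (L : ℝ) ^ 2)
        - Real.log (Matrix.partitionFn β₁ (dWaveSourceTorus L U μ h)).re / (β₁ * (L : ℝ) ^ 2)))
      ≤ Real.log (Matrix.partitionFn β (dWaveSourceTorus L U μ h)).re / (β * (L : ℝ) ^ 2)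
        - Real.log (Matrix.partitionFn β (dWaveSourceTorus L U μ 0)).re / (β * (L : ℝ) ^ 2) := by
  have hβ : 0 < β := lt_of_lt_of_le hβ₁ hle
  have hL : 0 < ((L : ℝ)) ^ 2 := by
    have : (0 : ℝ) < (L : ℝ) := by exact_mod_cast Nat.pos_of_ne_zero (NeZero.ne L)
    positivity
  have key := thermalRatchet_corrected (dWaveSourceTorus L U μ 0) (dWaveSourceTorus L U μ h)
    (dWaveSourceTorus_isHermitian L (isHermitian_hubbardTorusWith L 1 U μ) 0)
    (dWaveSourceTorus_isHermitian L (isHermitian_hubbardTorusWith L 1 U μ) h) hβ₁ hle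
  set L11 := Real.log (Matrix.partitionFn β₁ (dWaveSourceTorus L U μ h)).re
  set L1h := Real.log (Matrix.partitionFn (β₁ / 2) (dWaveSourceTorus L U μ h)).re
  set L01 := Real.log (Matrix.partitionFn β₁ (dWaveSourceTorus L U μ 0)).re
  set Lb1 := Real.log (Matrix.partitionFn β (dWaveSourceTorus L U μ h)).re
  set Lb0 := Real.log (Matrix.partitionFn β (dWaveSourceTorus L U μ 0)).re
  have hb1 : β₁ ≠ 0 := hβ₁.ne'
  have hb : β ≠ 0 := hβ.ne'
  have hL' : ((L : ℝ)) ^ 2 ≠ 0 := hL.ne'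
  have lhs : (L11 / (β₁ * (L : ℝ) ^ 2) - L01 / (β₁ * (L : ℝ) ^ 2))
      - (L1h / (β₁ / 2 * (L : ℝ) ^ 2) - L11 / (β₁ * (L : ℝ) ^ 2))
      = ((2 * L11 - 2 * L1h - L01) / β₁) / (L : ℝ) ^ 2 := by
    field_simp
    ring
  have rhs : Lb1 / (β * (L : ℝ) ^ 2) - Lb0 / (β * (L : ℝ) ^ 2) = ((Lb1 - Lb0) / β) / (L : ℝ) ^ 2 := by
    field_simp
  rw [lhs, rhs]
  exact div_le_div_of_nonneg_right key hL.le

end CruxTriage1697
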